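import Literature.Analysis.FluidPDE.BesovScaledEnergyBounds
import Literature.Analysis.FluidPDE.BesovBlowupConcentration
import Literature.Analysis.FluidPDE.BlowupLimitBounds
import Literature.Analysis.FluidPDE.BlowupBesovSlices
import Literature.Analysis.FluidPDE.BlowupFarField
import Literature.Analysis.FluidPDE.AncientFarFieldBound
import Literature.Analysis.FluidPDE.AncientLimitVanishingScaled
import Literature.Analysis.FluidPDE.BlowupTopVanishing
import Literature.Analysis.FluidPDE.BesovSliceLiouville
import Literature.Analysis.FluidPDE.LerayHopfFinalTimeDistribution
import Literature.Analysis.FluidPDE.CriticalBesovRescalingVanishing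
import Literature.Analysis.FluidPDE.CriticalSpacesTranslate
import HarnessLib

/-!
# Regularity at the final time of classical solutions bounded in a critical Besov space
# (Gallagher–Koch–Planchon 2016, Thm. 1, along Wang–Zhang 2017, §4)

Analysis/FluidPDE proofs-only file (theorems only: no definition, no named fact; nothing accepted
is restated or changed). This file assembles the blow-up/rigidity proof of the continuation
criterion `hasSmoothExtensionPast_of_eHomBesovNorm_bounded` (I. Gallagher, G. Koch, F. Planchon,
Comm. Math. Phys. 343 (2016), Thm. 1) for classical Leray–Hopf solutions with unit viscosity, in
the form consumed by the tree's landing pad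
`hasSmoothExtensionPast_of_eHomBesovNorm_bounded_of_classical_regular`: **every point `(T, x₀)` of
the final time is regular** (`regular_at_final_time_of_classical_besov_bounded`), following W. Wang,
Z. Zhang, Sci. China Math. 60 (2017) = arXiv:1510.02589, §4 (the route that extends the
Escauriaza–Seregin–Šverák blow-up and backward uniqueness argument to `Ḃ^{-1+3/p}_{p,q}`,
`3 < p, q < ∞`, and which Gallagher–Koch–Planchon cite as the alternative to their
profile-decomposition proof).

The steps and the tree theorems that carry them: uniform scale-invariant bounds (Lemma 4.1,
`exists_scaledEnergies_bounded_of_classical_besov`); if `(T, x₀)` were singular, `C + D` would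
concentrate at all small scales at `(T, x₀)` (`eLpNorm_top_lt_top_of_cknC_add_cknD_lt`), hence
`C` would (`exists_forall_le_cknC_of_forall_le_cknC_add_cknD`); the blow-up limit `(w, π)` of the
dyadic zooms (`exists_zoom_blowup_limit`) is a local energy ancient solution with bounded `A, C, D`
at all apices (`blowup_cknC_le_apex`, …), Besov slices (`blowup_ae_slice_memHomBesov`, (4.4)),
vanishing weakly at the top (Step 2, `top_vanishing_of_modulus_of_apexTrace`, the apex trace being
the rescaled final datum whose critical rescalings tend to zero), small far out
(`farField_cknC_small_of_ae_slice_memHomBesov`) hence bounded far out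
(`exists_farField_ae_norm_le_of_cknC_farField_small`), with the Liouville property of its slices
(`ae_liouville_of_ae_uloc_of_ae_memHomBesov`, Step 3); so it vanishes near the origin
(`ancient_lintegral_cube_eq_zero_of_farField_le`, backward uniqueness and unique continuation,
Steps 3–4), contradicting the non-triviality of a blow-up limit at a point of concentration
(`blowup_lintegral_cube_ge_of`).

## References

* I. Gallagher, G. S. Koch, F. Planchon, Comm. Math. Phys. 343 (2016) 39–82, Thm. 1. [GKP2016]
* W. Wang, Z. Zhang, Sci. China Math. 60 (2017) 637–650 = arXiv:1510.02589, §4. [WangZhang2016]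
* L. Escauriaza, G. Seregin, V. Šverák, Russ. Math. Surveys 58 (2003), Thm. 1.4, §§3–5.
  [EscauriazaSereginSverak2003]
-/

noncomputable section

open MeasureTheory Set Function Filter Topology TopologicalSpace Metric
open scoped NNReal ENNReal RealInnerProductSpace SchwartzMap

namespace Literature.Analysis.FluidPDE

open FunctionSpaces.EuclideanSpace (complexify)

/-! ### Composition of zooms -/

section Zoom

/-- Zooming a zoom: `(v ↦ c v(c²·, c·)) ∘ (u ↦ λ u(t₀ + λ²·, x₀ + λ·)) = (u ↦ (cλ) u(t₀ + (cλ)²·, x₀ + (cλ)·))`.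
[folklore] -/
theorem zoom_zoom_velocity (c lam t₀ : ℝ) (x₀ : EuclideanSpace ℝ (Fin 3))
    (u : ℝ → EuclideanSpace ℝ (Fin 3) → EuclideanSpace ℝ (Fin 3)) :
    c • stPull (c ^ 2) c (0 : ℝ) (0 : EuclideanSpace ℝ (Fin 3)) (lam • stPull (lam ^ 2) lam t₀ x₀ u) =
      (c * lam) • stPull ((c * lam) ^ 2) (c * lam) t₀ x₀ u := by
  funext s y
  simp only [Pi.smul_apply, stPull_apply, zero_add, smul_smul]
  congr 2
  · ring
  · rw [mul_comm c lam, mul_smul]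

/-- The same for the pressures (weights `c²`, `λ²`). [folklore] -/
theorem zoom_zoom_pressure (c lam t₀ : ℝ) (x₀ : EuclideanSpace ℝ (Fin 3))
    (p : ℝ → EuclideanSpace ℝ (Fin 3) → ℝ) :
    c ^ 2 • stPull (c ^ 2) c (0 : ℝ) (0 : EuclideanSpace ℝ (Fin 3)) (lam ^ 2 • stPull (lam ^ 2) lam t₀ x₀ p) =
      (c * lam) ^ 2 • stPull ((c * lam) ^ 2) (c * lam) t₀ x₀ p := by
  funext s y
  simp only [Pi.smul_apply, stPull_apply, zero_add, smul_eq_mul]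
  rw [mul_pow, ← mul_assoc]
  congr 2
  · ring
  · rw [mul_comm c lam, mul_smul]

end Zoom

/-! ### Real pairings from complex Schwartz pairings -/

section RealPairing

/-- **Vanishing of all complex Schwartz pairings gives vanishing of the real pairings with smooth
compactly supported vector fields** (componentwise: `⟪f, φ⟫ = Σᵢ Re (θᵢ • f_ℂ)ᵢ` with
`θᵢ = φᵢ` viewed as a complex Schwartz function). [folklore] -/
theorem tendsto_integral_inner_of_tendsto_integral_smul_complexify {α : Type*} {l : Filter α}
    {f : α → EuclideanSpace ℝ (Fin 3) → EuclideanSpace ℝ (Fin 3)}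
    (hint : ∀ (n : α) (θ : 𝓢(EuclideanSpace ℝ (Fin 3), ℂ)),
      Integrable (fun x => θ x • complexify (f n x)))
    (h : ∀ θ : 𝓢(EuclideanSpace ℝ (Fin 3), ℂ),
      Tendsto (fun n => ∫ x, θ x • complexify (f n x)) l (𝓝 0))
    {φ : EuclideanSpace ℝ (Fin 3) → EuclideanSpace ℝ (Fin 3)} (hφ : ContDiff ℝ (⊤ : ℕ∞) φ)
    (hφc : HasCompactSupport φ) :
    Tendsto (fun n => ∫ x, ⟪f n x, φ x⟫) l (𝓝 0) := by
  classical
  -- the complex Schwartz components of `φ`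
  have hcomp : ∀ i : Fin 3, ContDiff ℝ (⊤ : ℕ∞) fun x => ((φ x i : ℝ) : ℂ) := fun i =>
    Complex.ofRealCLM.contDiff.comp ((EuclideanSpace.proj i : EuclideanSpace ℝ (Fin 3) →L[ℝ] ℝ).contDiff.comp hφ)
  have hcompc : ∀ i : Fin 3, HasCompactSupport fun x => ((φ x i : ℝ) : ℂ) := fun i => by
    refine (hφc.comp_left (g := fun v : EuclideanSpace ℝ (Fin 3) => ((v i : ℝ) : ℂ)) ?_)
    simp
  set θ : Fin 3 → 𝓢(EuclideanSpace ℝ (Fin 3), ℂ) := fun i => (hcompc i).toSchwartzMap (hcomp i) with hθ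
  have hθx : ∀ i x, θ i x = ((φ x i : ℝ) : ℂ) := fun i x => rfl
  -- the pointwise identity `⟪f, φ⟫ = Σᵢ Re ((θᵢ • f_ℂ) i)`
  have hpt : ∀ n x, ⟪f n x, φ x⟫ = ∑ i : Fin 3, (((θ i x) • complexify (f n x)) i).re := by
    intro n x
    have e1 : ⟪f n x, φ x⟫ = ∑ i : Fin 3, f n x i * φ x i := by
      rw [real_inner_comm, EuclideanSpace.inner_eq_star_dotProduct]
      simp [dotProduct]
    rw [e1]
    refine Finset.sum_congr rfl fun i _ => ?_
    rw [hθx]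
    simp [FunctionSpaces.EuclideanSpace.complexify_apply, mul_comm]
  -- integrability of the summands
  have hsummand : ∀ n i, Integrable fun x => (((θ i x) • complexify (f n x)) i).re := fun n i =>
    ((EuclideanSpace.proj (𝕜 := ℂ) i).integrable_comp (hint n (θ i))).re
  -- the integrals as real parts of components of the complex pairings
  have hId : ∀ n, ∫ x, ⟪f n x, φ x⟫ = ∑ i : Fin 3, ((∫ x, (θ i x) • complexify (f n x)) i).re := by
    intro n
    simp_rw [hpt n]
    rw [integral_finsetSum _ fun i _ => hsummand n i]
    refine Finset.sum_congr rfl fun i _ => ?_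
    have h1 : (∫ x, (θ i x) • complexify (f n x)) i = ∫ x, ((θ i x) • complexify (f n x)) i := by
      rw [show (∫ x, (θ i x) • complexify (f n x)) i =
          EuclideanSpace.proj (𝕜 := ℂ) i (∫ x, (θ i x) • complexify (f n x)) from rfl,
        ← (EuclideanSpace.proj (𝕜 := ℂ) i).integral_comp_comm (hint n (θ i))]
      rfl
    rw [h1]
    have h2 := integral_re ((EuclideanSpace.proj (𝕜 := ℂ) i).integrable_comp (hint n (θ i)))
    simpa using h2
  simp_rw [hId]
  rw [show (0 : ℝ) = ∑ i : Fin 3, ((0 : EuclideanSpace ℂ (Fin 3)) i).re by simp]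
  refine tendsto_finsetSum _ fun i _ => ?_
  exact (Complex.continuous_re.tendsto _).comp
    (((EuclideanSpace.proj (𝕜 := ℂ) i).continuous.tendsto _).comp (h (θ i)))

end RealPairing

/-! ### The apex trace of the pre-zoomed classical solution and its critical rescalings -/

section ApexTrace

variable {u : ℝ → EuclideanSpace ℝ (Fin 3) → EuclideanSpace ℝ (Fin 3)} {T ν : ℝ}
  {f : ℝ → EuclideanSpace ℝ (Fin 3) → EuclideanSpace ℝ (Fin 3)}
  {u₀ : EuclideanSpace ℝ (Fin 3) → EuclideanSpace ℝ (Fin 3)}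

/-- **Change of variables for the zoomed pairings**:
`∫ ⟪λ g(x₀ + λ x), θ x⟫ dx = λ⁻² ∫ ⟪g y, θ(λ⁻¹(y - x₀))⟫ dy`. [folklore] -/
theorem integral_inner_smul_comp_zoom_eq {lam : ℝ} (hlam : 0 < lam) (x₀ : EuclideanSpace ℝ (Fin 3))
    (g : EuclideanSpace ℝ (Fin 3) → EuclideanSpace ℝ (Fin 3))
    (θ : EuclideanSpace ℝ (Fin 3) → EuclideanSpace ℝ (Fin 3)) :
    ∫ x, ⟪lam • g (x₀ + lam • x), θ x⟫ = (lam ^ 2)⁻¹ * ∫ y, ⟪g y, θ (lam⁻¹ • (y - x₀))⟫ := by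
  have hlam0 : lam ≠ 0 := hlam.ne'
  set F : EuclideanSpace ℝ (Fin 3) → ℝ := fun y => ⟪g y, θ (lam⁻¹ • (y - x₀))⟫ with hF
  have e1 : (fun x => ⟪lam • g (x₀ + lam • x), θ x⟫) = fun x => lam * (fun z => F (x₀ + z)) (lam • x) := by
    funext x
    rw [real_inner_smul_left, hF]
    dsimp only
    rw [add_sub_cancel_left, smul_smul, inv_mul_cancel₀ hlam0, one_smul]
  rw [e1, integral_const_mul, Measure.integral_comp_smul_of_nonneg volume (fun z => F (x₀ + z)) lam
    (hR := hlam.le), finrank_euclideanSpace_fin, smul_eq_mul]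
  have e2 : ∫ z, F (x₀ + z) = ∫ y, F y := integral_add_left_eq_self F x₀
  rw [e2, ← mul_assoc]
  congr 1
  field_simp

/-- **The apex trace of the zoom of a Leray–Hopf solution at the final time** (the hypothesis
`htrace` of `top_vanishing_of_modulus_of_apexTrace`): for `v(s, y) = λ u(T + λ² s, x₀ + λ y)` and
`v̂(y) = λ u(T)(x₀ + λ y)`, the pairings `∫_{B(0,1/2)} ⟪v(s), θ⟫` with test functions on the ball
tend to `∫ ⟪v̂, θ⟫` as `s ↑ 0` (weak `L²` continuity of Leray–Hopf solutions at `T`, Leray 1934,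
§31). [cite: Leray1934, §31] -/
theorem apexTrace_zoom_of_lerayHopf (hLH : IsLerayHopfOn T ν f u₀ u) (hT : 0 < T) {lam : ℝ}
    (hlam : 0 < lam) (x₀ : EuclideanSpace ℝ (Fin 3))
    (θ : EuclideanSpace ℝ (Fin 3) → EuclideanSpace ℝ (Fin 3))
    (hθ : FunctionSpaces.IsTestFunctionOn
      (⟨ball (0 : EuclideanSpace ℝ (Fin 3)) (1 / 2), isOpen_ball⟩ : Opens (EuclideanSpace ℝ (Fin 3))) θ)
    {ε : ℝ} (hε : 0 < ε) :
    ∃ τ : ℝ, 0 < τ ∧ ∀ᵐ t ∂(volume.restrict (Ioo ((0 : ℝ) - τ) 0)),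
      |(∫ x in ball (0 : EuclideanSpace ℝ (Fin 3)) (1 / 2),
          ⟪(lam • stPull (lam ^ 2) lam T x₀ u) t x, θ x⟫) -
        ∫ x, ⟪lam • u T (x₀ + lam • x), θ x⟫| ≤ ε := by
  have hlam0 : lam ≠ 0 := hlam.ne'
  have hlam2 : 0 < lam ^ 2 := pow_pos hlam 2
  -- the dilated test function is in `L²`
  set w' : EuclideanSpace ℝ (Fin 3) → EuclideanSpace ℝ (Fin 3) := fun y => θ (lam⁻¹ • (y - x₀)) with hw'
  have hw'c : Continuous w' :=
    hθ.contDiff.continuous.comp ((continuous_id.sub continuous_const).const_smul lam⁻¹)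
  have hw'supp : HasCompactSupport w' := by
    have h1 : w' = (fun z => θ (lam⁻¹ • z)) ∘ (Homeomorph.addRight (-x₀) :
        EuclideanSpace ℝ (Fin 3) ≃ₜ EuclideanSpace ℝ (Fin 3)) := by
      funext y
      simp [hw', sub_eq_add_neg]
    rw [h1]
    exact (hθ.hasCompactSupport.comp_smul (inv_ne_zero hlam0)).comp_homeomorph _
  have hw'mem : MemLp w' 2 volume := hw'c.memLp_of_hasCompactSupport hw'supp
  set P : ℝ → ℝ := fun s => ∫ y, ⟪u s y, w' y⟫ with hP
  obtain ⟨hcont, -⟩ := hLH.weak_continuous w' hw'mem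
  have hcwa : ContinuousWithinAt P (Ioc 0 T) T := hcont T ⟨hT, le_rfl⟩
  rw [Metric.continuousWithinAt_iff] at hcwa
  obtain ⟨δ, hδ, hδP⟩ := hcwa (lam ^ 2 * ε) (by positivity)
  refine ⟨min δ T / lam ^ 2, by positivity, ?_⟩
  rw [ae_restrict_iff' measurableSet_Ioo]
  refine ae_of_all _ fun t ht => ?_
  have hmin : 0 < min δ T := lt_min hδ hT
  have ht1 : -(min δ T) < lam ^ 2 * t := by
    have h : -(min δ T / lam ^ 2) < t := by rw [← zero_sub]; exact ht.1
    have h2 := mul_lt_mul_of_pos_left h hlam2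
    rwa [mul_neg, mul_div_cancel₀ _ hlam2.ne'] at h2
  set s : ℝ := T + lam ^ 2 * t with hsdef
  have hs : s ∈ Ioc 0 T := by
    refine ⟨?_, ?_⟩
    · have : min δ T ≤ T := min_le_right _ _
      rw [hsdef]; linarith
    · have : lam ^ 2 * t < 0 := mul_neg_of_pos_of_neg hlam2 ht.2
      rw [hsdef]; linarith
  have hdist : dist s T < δ := by
    rw [Real.dist_eq, hsdef, show T + lam ^ 2 * t - T = lam ^ 2 * t by ring, abs_of_neg
      (mul_neg_of_pos_of_neg hlam2 ht.2)]
    have : min δ T ≤ δ := min_le_left _ _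
    linarith
  have key := hδP hs hdist
  rw [Real.dist_eq] at key
  -- the two pairings through `P`
  have e0 : ∫ x in ball (0 : EuclideanSpace ℝ (Fin 3)) (1 / 2),
      ⟪(lam • stPull (lam ^ 2) lam T x₀ u) t x, θ x⟫ =
      ∫ x, ⟪(lam • stPull (lam ^ 2) lam T x₀ u) t x, θ x⟫ := by
    refine setIntegral_eq_integral_of_forall_compl_eq_zero fun x hx => ?_
    have : θ x = 0 := image_eq_zero_of_notMem_tsupport fun h => hx (hθ.tsupport_subset h)
    rw [this, inner_zero_right]
  have e1 : ∫ x, ⟪(lam • stPull (lam ^ 2) lam T x₀ u) t x, θ x⟫ = (lam ^ 2)⁻¹ * P s := by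
    have h1 : (fun x => ⟪(lam • stPull (lam ^ 2) lam T x₀ u) t x, θ x⟫) =
        fun x => ⟪lam • u s (x₀ + lam • x), θ x⟫ := by
      funext x
      simp only [Pi.smul_apply, stPull_apply, hsdef]
    rw [h1, integral_inner_smul_comp_zoom_eq hlam x₀ (u s) θ]
  have e2 : ∫ x, ⟪lam • u T (x₀ + lam • x), θ x⟫ = (lam ^ 2)⁻¹ * P T :=
    integral_inner_smul_comp_zoom_eq hlam x₀ (u T) θ
  rw [e0, e1, e2, ← mul_sub, abs_mul, abs_inv, abs_of_pos hlam2]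
  calc (lam ^ 2)⁻¹ * |P s - P T| ≤ (lam ^ 2)⁻¹ * (lam ^ 2 * ε) :=
        mul_le_mul_of_nonneg_left key.le (inv_nonneg.2 hlam2.le)
    _ = ε := by field_simp

/-- **The critical rescalings of the apex trace tend to zero** (the hypothesis `hvan` of
`top_vanishing_of_modulus_of_apexTrace`; Wang–Zhang 2017, §4 Step 2, "`u(x, T)`, hence `v(x, 0)`,
carries no concentration"): for `v̂(y) = λ u_T(x₀ + λ y)` with `λ = 2^{-n₀}` and `u_T` represented by
a realised `Ḃ^{-1+3/p}_{p,q}` distribution (`3 < p`, `0 < q < ∞`),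
`4ⁿ ∫ ⟪v̂(x), φ(2ⁿ x)⟫ dx = ∫ ⟪2^{-(n+n₀)} u_T(x₀ + 2^{-(n+n₀)} y), φ(y)⟫ dy → 0`. [cite: WangZhang2016, §4 Step 2] -/
theorem apex_rescaling_vanishing {uT : EuclideanSpace ℝ (Fin 3) → EuclideanSpace ℝ (Fin 3)}
    {UT : 𝓢'(EuclideanSpace ℝ (Fin 3), EuclideanSpace ℂ (Fin 3))} (hUT : IsDistributionOf uT UT)
    {p q : ℝ≥0∞} [Fact (1 ≤ p)] (hp : 3 < p) (hq₀ : q ≠ 0) (hq : q ≠ ⊤)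
    (hB : FunctionSpaces.MemHomBesov (-1 + 3 / p.toReal) p q UT)
    (x₀ : EuclideanSpace ℝ (Fin 3)) (n₀ : ℕ)
    {φ : EuclideanSpace ℝ (Fin 3) → EuclideanSpace ℝ (Fin 3)} (hφ : ContDiff ℝ (⊤ : ℕ∞) φ)
    (hφc : HasCompactSupport φ) :
    Tendsto (fun n : ℕ => (((1 / 2 : ℝ) ^ n) ^ 2)⁻¹ *
      ∫ x, ⟪((1 / 2 : ℝ) ^ n₀) • uT (x₀ + ((1 / 2 : ℝ) ^ n₀) • x),
        φ (((1 / 2 : ℝ) ^ n)⁻¹ • (x - (0 : EuclideanSpace ℝ (Fin 3))))⟫) atTop (𝓝 0) := by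
  -- the translated datum and its distribution
  set g : EuclideanSpace ℝ (Fin 3) → EuclideanSpace ℝ (Fin 3) := fun y => uT (y + x₀) with hgdef
  have hg : IsDistributionOf g (FunctionSpaces.distribTranslate (EuclideanSpace ℂ (Fin 3)) (-x₀) UT) :=
    hUT.translate_add x₀
  have hBg : FunctionSpaces.MemHomBesov (-1 + 3 / p.toReal) p q
      (FunctionSpaces.distribTranslate (EuclideanSpace ℂ (Fin 3)) (-x₀) UT) := hB.distribTranslate (-x₀)
  -- the identity with the rescaled translates
  have hId : ∀ n : ℕ, (((1 / 2 : ℝ) ^ n) ^ 2)⁻¹ *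
      ∫ x, ⟪((1 / 2 : ℝ) ^ n₀) • uT (x₀ + ((1 / 2 : ℝ) ^ n₀) • x),
        φ (((1 / 2 : ℝ) ^ n)⁻¹ • (x - (0 : EuclideanSpace ℝ (Fin 3))))⟫ =
      ∫ y, ⟪rescaleData ((2 : ℝ) ^ (-((n + n₀ : ℕ) : ℤ))) g y, φ y⟫ := by
    intro n
    set c : ℝ := (1 / 2 : ℝ) ^ n with hc
    have hcpos : 0 < c := by positivity
    have hc0 : c ≠ 0 := hcpos.ne'
    set F : EuclideanSpace ℝ (Fin 3) → ℝ := fun x =>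
      ⟪((1 / 2 : ℝ) ^ n₀) • uT (x₀ + ((1 / 2 : ℝ) ^ n₀) • x), φ (c⁻¹ • (x - 0))⟫ with hF
    have h1 : ∫ x, F x = c ^ 3 * ∫ y, F (c • y) := by
      rw [Measure.integral_comp_smul_of_nonneg volume F c (hR := hcpos.le), finrank_euclideanSpace_fin,
        smul_eq_mul, ← mul_assoc, mul_inv_cancel₀ (pow_ne_zero 3 hc0), one_mul]
    have h2 : ∀ y, F (c • y) = c⁻¹ * ⟪rescaleData ((2 : ℝ) ^ (-((n + n₀ : ℕ) : ℤ))) g y, φ y⟫ := by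
      intro y
      rw [hF]
      dsimp only
      have e : (2 : ℝ) ^ (-((n + n₀ : ℕ) : ℤ)) = c * (1 / 2 : ℝ) ^ n₀ := by
        rw [zpow_neg, zpow_natCast, hc, ← pow_add, one_div, inv_pow]
      simp only [sub_zero, smul_smul]
      rw [inv_mul_cancel₀ hc0, one_smul, rescaleData_apply, e, hgdef]
      dsimp only
      rw [real_inner_smul_left, real_inner_smul_left, mul_comm ((1 / 2 : ℝ) ^ n₀) c,
        add_comm (((c * (1 / 2 : ℝ) ^ n₀)) • y) x₀]
      field_simp
    show (c ^ 2)⁻¹ * ∫ x, F x = _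
    rw [h1]
    simp_rw [h2]
    rw [integral_const_mul]
    field_simp
  simp_rw [hId]
  -- the complex pairings of the rescaled translates tend to zero
  have hscale : Tendsto (fun n : ℕ => -((n + n₀ : ℕ) : ℤ)) atTop atBot := by
    refine tendsto_neg_atTop_atBot.comp ?_
    exact (tendsto_natCast_atTop_atTop (R := ℤ)).comp (tendsto_add_atTop_nat n₀)
  refine tendsto_integral_inner_of_tendsto_integral_smul_complexify (l := atTop)
    (f := fun n : ℕ => rescaleData ((2 : ℝ) ^ (-((n + n₀ : ℕ) : ℤ))) g) (fun n θ => ?_) (fun θ => ?_) hφ hφc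
  · have h := hg.rescaleData (Units.mk0 ((2 : ℝ) ^ (-((n + n₀ : ℕ) : ℤ))) (zpow_ne_zero _ two_ne_zero))
    rw [Units.val_mk0] at h
    exact (h θ).1
  · exact (hg.tendsto_integral_smul_rescaleData_atBot hp hq₀ hq hBg θ).comp hscale

end ApexTrace

/-! ### Regularity at the final time -/

section Main

variable {u : ℝ → EuclideanSpace ℝ (Fin 3) → EuclideanSpace ℝ (Fin 3)}
  {p : ℝ → EuclideanSpace ℝ (Fin 3) → ℝ}
  {U : ℝ → 𝓢'(EuclideanSpace ℝ (Fin 3), EuclideanSpace ℂ (Fin 3))}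

set_option maxHeartbeats 6400000 in
/-- **Gallagher–Koch–Planchon 2016, Thm. 1, for classical Leray–Hopf solutions with unit
viscosity, as regularity at the final time** (proof along Wang–Zhang 2017, §4; see the module
docstring): if `u` is a classical solution of the Navier–Stokes equations on `ℝ³ × [0, T)`,
Leray–Hopf from its datum, whose slices are represented by tempered distributions bounded in
`Ḃ^{-1+3/r}_{r,q}`, `3 < r, q < ∞`, then every point `(T, x₀)` is regular: `u` is essentially
bounded on some `Q_ρ(T, x₀)`. [cite: GKP2016, Thm. 1] [cite: WangZhang2016, §4 Steps 1–4] -/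
theorem regular_at_final_time_of_classical_besov_bounded
    {r q : ℝ≥0∞} [Fact (1 ≤ r)] (hr3 : 3 < r) (hr : r < ⊤) (hq3 : 3 < q) (hq : q < ⊤)
    {T : ℝ} (hT : 0 < T)
    (hsol : IsClassicalNSSolutionOn (Ico 0 T) 1 0 u p) (hLH : IsLerayHopfOn T 1 0 (u 0) u)
    (hU : ∀ t ∈ Ico 0 T, IsDistributionOf (u t) (U t))
    (hsup : (⨆ t ∈ Ico 0 T, FunctionSpaces.eHomBesovNorm (-1 + 3 / r.toReal) r q (U t)) < ⊤)
    (x₀ : EuclideanSpace ℝ (Fin 3)) :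
    ∃ ρ : ℝ, 0 < ρ ∧ eLpNorm (uncurry u) ∞ (volume.restrict (parabolicCylinder ρ ((T : ℝ), x₀))) < ∞ := by
  classical
  -- ### Step 0: the Besov bound, the uniform scale-invariant bounds, the `ε`-regularity constants
  have hrtop : r ≠ ⊤ := hr.ne
  have hqtop : q ≠ ⊤ := hq.ne
  have hq0 : q ≠ 0 := (lt_trans (by norm_num) hq3).ne'
  obtain ⟨hs, hs0⟩ := neg_two_lt_criticalIndex_and_lt_zero hr3
  set M : ℝ≥0 := (⨆ t ∈ Ico 0 T, FunctionSpaces.eHomBesovNorm (-1 + 3 / r.toReal) r q (U t)).toNNReal with hMdef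
  have hM : ∀ t ∈ Ico 0 T, FunctionSpaces.eHomBesovNorm (-1 + 3 / r.toReal) r q (U t) ≤ M := by
    intro t ht
    rw [hMdef, ENNReal.coe_toNNReal hsup.ne]
    exact le_iSup₂ (f := fun t (_ : t ∈ Ico 0 T) => FunctionSpaces.eHomBesovNorm (-1 + 3 / r.toReal) r q (U t)) t ht
  obtain ⟨K, R₁, hR₁, hR₁T, hbd⟩ := exists_scaledEnergies_bounded_of_classical_besov hr3 hrtop hq0 hT hsol hLH hU hM
  obtain ⟨ε₁, cM, hε₁, hcM, H⟩ := RRS2016.theorem15_3_holds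
  set qg : ℝ → EuclideanSpace ℝ (Fin 3) → ℝ := fun t x => p t x - (p t 0 - normalisedPressure (u t) 0) with hqg
  set Q : Opens (ℝ × EuclideanSpace ℝ (Fin 3)) :=
    ⟨Ioo 0 T ×ˢ univ, isOpen_Ioo.prod isOpen_univ⟩ with hQdef
  have hQ : (Q : Set (ℝ × EuclideanSpace ℝ (Fin 3))) ⊆ Ioo 0 T ×ˢ univ := Subset.rfl
  have hsw : IsSuitableWeakSolutionOn Q 1 0 u qg :=
    SereginSverak2002.isSuitableWeakSolutionOn_gauge_of_classical one_pos hT hsol hLH Q hQ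
  have hR₁sqT : R₁ ^ 2 < T := by nlinarith
  have hTI : T ∈ Icc (T / 2) T := ⟨by linarith, le_rfl⟩
  -- the bounds at the apex `(T, x₀)` and at the apices of the window
  have hCb : ∀ t₀ ∈ Icc (T / 2) T, ∀ (x : EuclideanSpace ℝ (Fin 3)), ∀ ρ ∈ Ioc 0 R₁, cknC ρ (t₀, x) u ≤ K :=
    fun t₀ ht₀ x ρ hρ => le_trans (le_add_self.trans le_self_add) (hbd t₀ ht₀ x ρ hρ)
  have hDb : ∀ t₀ ∈ Icc (T / 2) T, ∀ (x : EuclideanSpace ℝ (Fin 3)), ∀ ρ ∈ Ioc 0 R₁, cknD ρ (t₀, x) qg ≤ K :=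
    fun t₀ ht₀ x ρ hρ => le_trans le_add_self (hbd t₀ ht₀ x ρ hρ)
  have hAb : ∀ t₀ ∈ Icc (T / 2) T, ∀ (x : EuclideanSpace ℝ (Fin 3)), ∀ ρ ∈ Ioc 0 R₁, cknAEss ρ (t₀, x) u ≤ K :=
    fun t₀ ht₀ x ρ hρ => le_trans (le_self_add.trans (le_self_add.trans le_self_add)) (hbd t₀ ht₀ x ρ hρ)
  have hEb : ∀ t₀ ∈ Icc (T / 2) T, ∀ (x : EuclideanSpace ℝ (Fin 3)), ∀ ρ ∈ Ioc 0 R₁,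
      cknE ρ (t₀, x) (fun t x => fderiv ℝ (u t) x) ≤ K :=
    fun t₀ ht₀ x ρ hρ => le_trans (le_add_self.trans (le_self_add.trans le_self_add)) (hbd t₀ ht₀ x ρ hρ)
  -- ### Step 1: if `(T, x₀)` were singular, `C + D` would concentrate at all scales `≤ R₁`
  by_contra hsing
  push Not at hsing
  have hcyl : parabolicCylinder R₁ (T, x₀) ⊆ (Q : Set (ℝ × EuclideanSpace ℝ (Fin 3))) := by
    intro w hw
    rw [mem_parabolicCylinder] at hw
    exact ⟨⟨by nlinarith [hw.1.1], hw.1.2⟩, mem_univ _⟩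
  have hconcCD : ∀ ρ ∈ Ioc 0 R₁, ENNReal.ofReal ε₁ ≤ cknC ρ (T, x₀) u + cknD ρ (T, x₀) qg := by
    intro ρ hρ
    by_contra hlt
    rw [not_le] at hlt
    have hρT : ρ ^ 2 < T := lt_of_le_of_lt (pow_le_pow_left₀ hρ.1.le hρ.2 2) hR₁sqT
    have hreg := eLpNorm_top_lt_top_of_cknC_add_cknD_lt hT hsol hLH hε₁ H hρ.1 hρT hlt
    exact absurd hreg (not_lt.2 (hsing (ρ / 2) (by linarith [hρ.1])))
  -- ### Step 2: `C` concentrates at all scales `≤ R₁`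
  obtain ⟨η, hη, hconcC⟩ := exists_forall_le_cknC_of_forall_le_cknC_add_cknD hsw.distributional hcyl hε₁
    hconcCD (hDb T hTI x₀)
  -- ### Step 3: the dyadic pre-zoom about `(T, x₀)` and the blow-up limit
  obtain ⟨n₀, hn₀⟩ := exists_pow_lt_of_lt_one hR₁ (by norm_num : (1 / 2 : ℝ) < 1)
  set lam : ℝ := (1 / 2 : ℝ) ^ n₀ with hlamdef
  have hlampos : 0 < lam := by positivity
  have hlamR₁ : lam ≤ R₁ := hn₀.le
  have hlam2 : 0 < lam ^ 2 := pow_pos hlampos 2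
  set v : ℝ → EuclideanSpace ℝ (Fin 3) → EuclideanSpace ℝ (Fin 3) := lam • stPull (lam ^ 2) lam T x₀ u with hvdef
  set pv : ℝ → EuclideanSpace ℝ (Fin 3) → ℝ := lam ^ 2 • stPull (lam ^ 2) lam T x₀ qg with hpvdef
  have hst : ∀ z : ℝ × EuclideanSpace ℝ (Fin 3), stAffine (lam ^ 2) lam T x₀ z = (T + lam ^ 2 * z.1, x₀ + lam • z.2) :=
    fun z => by rw [show z = (z.1, z.2) from rfl, stAffine_apply]
  have hst0 : stAffine (lam ^ 2) lam T x₀ (0 : ℝ × EuclideanSpace ℝ (Fin 3)) = (T, x₀) := by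
    rw [hst]; simp
  -- apices of the window `[-T/(2λ²), 0] × ℝ³` and radii `≤ 1` are mapped into the window of `hbd`
  set τ : ℝ := T / (2 * lam ^ 2) with hτdef
  have hτpos : 0 < τ := by positivity
  have hapex : ∀ z : ℝ × EuclideanSpace ℝ (Fin 3), z.1 ≤ 0 → (0 : ℝ) - τ ≤ z.1 →
      T + lam ^ 2 * z.1 ∈ Icc (T / 2) T := by
    intro z hz1 hz2
    refine ⟨?_, by nlinarith⟩
    have h1 : -τ ≤ z.1 := by linarith
    have h2 : lam ^ 2 * (-τ) ≤ lam ^ 2 * z.1 := mul_le_mul_of_nonneg_left h1 hlam2.le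
    have h3 : lam ^ 2 * τ = T / 2 := by rw [hτdef]; field_simp
    linarith
  have hrad : ∀ ρ ∈ Ioc (0 : ℝ) 1, lam * ρ ∈ Ioc 0 R₁ := fun ρ hρ =>
    ⟨mul_pos hlampos hρ.1, (mul_le_of_le_one_right hlampos.le hρ.2).trans hlamR₁⟩
  have hCv : ∀ z : ℝ × EuclideanSpace ℝ (Fin 3), z.1 ≤ 0 → (0 : ℝ) - τ ≤ z.1 →
      ∀ ρ ∈ Ioc (0 : ℝ) 1, cknC ρ z v ≤ K := by
    intro z hz1 hz2 ρ hρ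
    rw [hvdef, cknC_nsZoom hlampos hρ.1 T x₀ z u, hst]
    exact hCb _ (hapex z hz1 hz2) _ _ (hrad ρ hρ)
  have hAv : ∀ z : ℝ × EuclideanSpace ℝ (Fin 3), z.1 ≤ 0 → (0 : ℝ) - τ ≤ z.1 →
      ∀ ρ ∈ Ioc (0 : ℝ) 1, cknAEss ρ z v ≤ K := by
    intro z hz1 hz2 ρ hρ
    rw [hvdef, cknAEss_nsZoom hlampos hρ.1 T x₀ z u, hst]
    exact hAb _ (hapex z hz1 hz2) _ _ (hrad ρ hρ)
  have hDv : ∀ z : ℝ × EuclideanSpace ℝ (Fin 3), z.1 ≤ 0 → (0 : ℝ) - τ ≤ z.1 →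
      ∀ ρ ∈ Ioc (0 : ℝ) 1, cknD ρ z pv ≤ K := by
    intro z hz1 hz2 ρ hρ
    rw [hpvdef, cknD_nsZoom hlampos hρ.1 T x₀ z qg, hst]
    exact hDb _ (hapex z hz1 hz2) _ _ (hrad ρ hρ)
  -- the bounds at the apex `0` for radii `≤ 1/2`
  have h00 : (0 : ℝ × EuclideanSpace ℝ (Fin 3)).1 ≤ 0 := le_rfl
  have h0τ : (0 : ℝ) - τ ≤ (0 : ℝ × EuclideanSpace ℝ (Fin 3)).1 := by simp [hτpos.le]
  have hhalf1 : ∀ ρ ∈ Ioc (0 : ℝ) (1 / 2), ρ ∈ Ioc (0 : ℝ) 1 := fun ρ hρ => ⟨hρ.1, hρ.2.trans (by norm_num)⟩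
  have hC0 : ∀ ρ ∈ Ioc (0 : ℝ) (1 / 2), cknC ρ 0 v ≤ K := fun ρ hρ => hCv 0 h00 h0τ ρ (hhalf1 ρ hρ)
  have hA0 : ∀ ρ ∈ Ioc (0 : ℝ) (1 / 2), cknAEss ρ 0 v ≤ K := fun ρ hρ => hAv 0 h00 h0τ ρ (hhalf1 ρ hρ)
  have hD0 : ∀ ρ ∈ Ioc (0 : ℝ) (1 / 2), cknD ρ 0 pv ≤ K := fun ρ hρ => hDv 0 h00 h0τ ρ (hhalf1 ρ hρ)
  -- the Albritton–Barker class of the zooms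
  have hEfin : ∀ ρ ∈ Ioc (0 : ℝ) R₁, ∫⁻ q' in parabolicCylinder ρ (T, x₀),
      ENNReal.ofReal (frobeniusNormSq (fderiv ℝ (u q'.1) q'.2)) < ∞ := by
    intro ρ hρ
    have h1 := hEb T hTI x₀ ρ hρ
    rw [cknE] at h1
    have hr0 : ENNReal.ofReal ρ ≠ 0 := (ENNReal.ofReal_pos.2 hρ.1).ne'
    have h2 := (ENNReal.inv_mul_le_iff hr0 ENNReal.ofReal_ne_top).1 h1
    exact lt_of_le_of_lt h2 (ENNReal.mul_lt_top ENNReal.ofReal_lt_top ENNReal.coe_lt_top)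
  have hInBallT : ∀ ρ ∈ Ioc (0 : ℝ) R₁, IsSuitableWeakSolutionInBall ρ (T, x₀) u qg := fun ρ hρ =>
    isSuitableWeakSolutionInBall_apex_of_classical hT hsol hLH
      ((pow_le_pow_left₀ hρ.1.le hρ.2 2).trans hR₁sqT.le) (hEfin ρ hρ)
  have hInBall_v : IsSuitableWeakSolutionInBall 1 0 v pv := by
    have h := (hInBallT lam ⟨hlampos, hlamR₁⟩).zoom hlampos
    exact h
  have hsuit : ∀ c ∈ Ioc (0 : ℝ) (1 / 2), IsSuitableWeakSolutionInBall 1 0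
      (c • stPull (c ^ 2) c (0 : ℝ × EuclideanSpace ℝ (Fin 3)).1 (0 : ℝ × EuclideanSpace ℝ (Fin 3)).2 v)
      (c ^ 2 • stPull (c ^ 2) c (0 : ℝ × EuclideanSpace ℝ (Fin 3)).1 (0 : ℝ × EuclideanSpace ℝ (Fin 3)).2 pv) := by
    intro c hc
    have hcl : c * lam ∈ Ioc (0 : ℝ) R₁ := by
      refine ⟨mul_pos hc.1 hlampos, ?_⟩
      calc c * lam ≤ 1 * lam := mul_le_mul_of_nonneg_right (hc.2.trans (by norm_num)) hlampos.le
        _ ≤ R₁ := by rw [one_mul]; exact hlamR₁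
    have h := (hInBallT (c * lam) hcl).zoom (mul_pos hc.1 hlampos)
    rw [Prod.fst_zero, Prod.snd_zero, hvdef, hpvdef, zoom_zoom_velocity, zoom_zoom_pressure]
    exact h
  have hvm : AEStronglyMeasurable (uncurry v)
      (volume.restrict (parabolicCylinder (1 / 2) (0 : ℝ × EuclideanSpace ℝ (Fin 3)))) :=
    (hInBall_v.1.distributional.1.aestronglyMeasurable).mono_measure
      (Measure.restrict_mono (parabolicCylinder_mono (by norm_num) (by norm_num) _) le_rfl)
  have hpvm : AEStronglyMeasurable (uncurry pv)
      (volume.restrict (parabolicCylinder (1 / 2) (0 : ℝ × EuclideanSpace ℝ (Fin 3)))) :=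
    (hInBall_v.1.distributional.2.2.1.aestronglyMeasurable).mono_measure
      (Measure.restrict_mono (parabolicCylinder_mono (by norm_num) (by norm_num) _) le_rfl)
  -- the blow-up limit
  obtain ⟨δ, w, π, -, hδge, hall⟩ := exists_zoom_blowup_limit (z₀ := 0) hvm hsuit hC0 hD0
  have hw : ∀ a : ℝ, 0 < a → IsSuitableWeakSolutionInBall a 0 w π := fun a ha => (hall a ha).1
  have hwm : ∀ a : ℝ, 0 < a → MemLp (uncurry w) 3
      (volume.restrict (parabolicCylinder a (0 : ℝ × EuclideanSpace ℝ (Fin 3)))) := fun a ha => (hall a ha).2.1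
  have hconv := fun a (ha : 0 < a) => (hall a ha).2.2.1
  have hπm : ∀ a : ℝ, 0 < a → MemLp (uncurry π) (3 / 2)
      (volume.restrict (parabolicCylinder a (0 : ℝ × EuclideanSpace ℝ (Fin 3)))) := fun a ha => (hw a ha).2.2.2
  have hweak := fun a (ha : 0 < a) => (hall a ha).2.2.2
  -- ### Step 4: bounds of the limit at every apex
  have hCw : ∀ z : ℝ × EuclideanSpace ℝ (Fin 3), z.1 ≤ 0 → ∀ ρ : ℝ, 0 < ρ → cknC ρ z w ≤ K :=
    fun z hz ρ hρ => blowup_cknC_le_apex hvm hτpos one_pos hCv hδge hwm hconv hz hρ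
  have hAw : ∀ z : ℝ × EuclideanSpace ℝ (Fin 3), z.1 ≤ 0 → ∀ ρ : ℝ, 0 < ρ → cknAEss ρ z w ≤ K :=
    fun z hz ρ hρ => blowup_cknAEss_le_apex hvm hτpos one_pos hAv hδge hwm hconv hz hρ
  have hDw : ∀ z : ℝ × EuclideanSpace ℝ (Fin 3), z.1 ≤ 0 → ∀ ρ : ℝ, 0 < ρ → cknD ρ z π ≤ K :=
    fun z hz ρ hρ => blowup_cknD_le_apex hpvm hτpos one_pos hDv hδge hπm hweak hz hρ
  -- ### Step 5: the slices of the limit (uniformly locally `L²`, Besov)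
  have hreal : ∀ t ∈ Ico 0 T, Tendsto (fun j : ℤ => FunctionSpaces.lowFreqCutoff j (U t)) atBot (𝓝 0) :=
    fun t ht => tendsto_lowFreqCutoff_of_memLp_two_holds (hLH.memLp t ⟨ht.1, ht.2.le⟩) (hU t ht)
  set cl : ℝˣ := Units.mk0 ((2 : ℝ) ^ (-(n₀ : ℤ))) (zpow_ne_zero _ two_ne_zero) with hcl
  have hclval : (cl : ℝ) = lam := by
    rw [hcl, Units.val_mk0, hlamdef, zpow_neg, zpow_natCast, one_div, inv_pow]
  set V : ℝ → 𝓢'(EuclideanSpace ℝ (Fin 3), EuclideanSpace ℂ (Fin 3)) := fun t =>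
    rescaleDistrib cl (FunctionSpaces.distribTranslate (EuclideanSpace ℂ (Fin 3)) (-x₀) (U (T + lam ^ 2 * t)))
    with hVdef
  have hV : ∀ t ∈ Ioo ((0 : ℝ × EuclideanSpace ℝ (Fin 3)).1 - τ) (0 : ℝ × EuclideanSpace ℝ (Fin 3)).1,
      IsDistributionOf (v t) (V t) ∧
      FunctionSpaces.MemHomBesov (-1 + 3 / r.toReal) r q (V t) ∧
      FunctionSpaces.eHomBesovNorm (-1 + 3 / r.toReal) r q (V t) ≤ M := by
    intro t ht
    simp only [Prod.fst_zero] at ht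
    have htime : T + lam ^ 2 * t ∈ Ico 0 T := by
      have h1 := hapex (t, 0) ht.2.le ht.1.le
      exact ⟨by linarith [h1.1], by nlinarith [ht.2]⟩
    have hmem : FunctionSpaces.MemHomBesov (-1 + 3 / r.toReal) r q (U (T + lam ^ 2 * t)) :=
      ⟨(hM _ htime).trans_lt ENNReal.coe_lt_top, hreal _ htime⟩
    refine ⟨?_, ?_, ?_⟩
    · have h := (hU _ htime).rescaleData_translate_add x₀ cl
      rw [hclval] at h
      have e : v t = fun y => lam • u (T + lam ^ 2 * t) (x₀ + lam • y) := by
        funext y; rw [hvdef]; simp only [Pi.smul_apply, stPull_apply]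
      rw [e]; exact h
    · exact memHomBesov_zoom x₀ _ hmem
    · rw [hVdef]
      dsimp only
      rw [hcl, eHomBesovNorm_zoom_eq]
      exact hM _ htime
  have hA5 : ∀ x : EuclideanSpace ℝ (Fin 3), cknAEss 5 ((0 : ℝ), x) w ≤ K := fun x =>
    hAw ((0 : ℝ), x) le_rfl 5 (by norm_num)
  have hslices := blowup_ae_slice_memHomBesov hvm hr3 hq0 hτpos hV hδge hwm hconv (by norm_num : (3 : ℝ) ≤ 5) hA5
  -- ### Step 6: the limit vanishes weakly at the top
  obtain ⟨UT, hUT, -, hUTmem, -⟩ := hLH.exists_isDistributionOf_final_memHomBesov hT hU hs hs0 r hq0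
    ENNReal.coe_ne_top hM
  have htop : ∀ φ : EuclideanSpace ℝ (Fin 3) → EuclideanSpace ℝ (Fin 3), ContDiff ℝ (⊤ : ℕ∞) φ →
      HasCompactSupport φ → ∀ ε : ℝ, 0 < ε →
        ∃ s₀ : ℝ, s₀ < 0 ∧ ∀ᵐ s ∂(volume.restrict (Ioo s₀ 0)), |∫ y, ⟪w s y, φ y⟫| ≤ ε := by
    intro φ hφ hφc ε hε
    refine top_vanishing_of_modulus_of_apexTrace (z₀ := 0) hvm hC0 ?_
      (vh := fun y => lam • u T (x₀ + lam • y)) ?_ ?_ hδge hwm hconv hφ hφc hε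
    · intro φ' hφ' hφ'c ρ hρ1 hφ'ρ
      have hsolv : IsDistributionalNSSolutionOn (parabolicCylinderOpens (1 / 2) 0) 1 0 v pv :=
        (hInBall_v.1.of_le (fun w' hw' => parabolicCylinder_mono (by norm_num) (by norm_num) _ hw')).distributional
      exact exists_uniform_pairing_modulus_of_bounds hsolv hA0 hD0 hφ' hφ'c hρ1 hφ'ρ
    · intro θ hθ ε' hε'
      simp only [Prod.fst_zero, Prod.snd_zero]
      have h := apexTrace_zoom_of_lerayHopf hLH hT hlampos x₀ θ hθ hε'
      rw [hvdef]
      exact h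
    · intro φ' hφ' hφ'c
      simp only [Prod.snd_zero]
      have h := apex_rescaling_vanishing hUT hr3 hq0 hqtop hUTmem x₀ n₀ hφ' hφ'c
      rw [hlamdef]
      exact h
  -- ### Step 7: far-field smallness, then boundedness far out
  have hKw : ∀ z : ℝ × EuclideanSpace ℝ (Fin 3), z.1 ≤ 0 → ∀ ρ : ℝ, 0 < ρ →
      cknC ρ z w ≤ K ∧ cknD ρ z π ≤ K := fun z hz ρ hρ => ⟨hCw z hz ρ hρ, hDw z hz ρ hρ⟩
  have hslice19 : ∀ᵐ t ∂(volume.restrict (Ioo (-((3 : ℝ) + 16)) 0)),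
      ∃ W : 𝓢'(EuclideanSpace ℝ (Fin 3), EuclideanSpace ℂ (Fin 3)),
        IsDistributionOf (w t) W ∧ FunctionSpaces.MemHomBesov (-1 + 3 / r.toReal) r q W := by
    have h := ae_restrict_of_ae_restrict_of_subset (Ioo_subset_Ioo (by norm_num) le_rfl :
      Ioo (-((3 : ℝ) + 16)) (0 : ℝ) ⊆ Ioo (-(5 : ℝ) ^ 2) 0) hslices
    filter_upwards [h] with t ht
    obtain ⟨-, W, hW, hWm, -⟩ := ht
    exact ⟨W, hW, hWm⟩
  have hfarC := farField_cknC_small_of_ae_slice_memHomBesov hw hKw hs hs0 hrtop hq0 hqtop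
    (by norm_num : (0 : ℝ) < 3) hslice19
  have hDK : ∀ z₀ : ℝ × EuclideanSpace ℝ (Fin 3), z₀.1 < 0 → cknD 1 z₀ π ≤ K := fun z₀ hz₀ =>
    hDw z₀ hz₀.le 1 one_pos
  have hfarC' : ∀ η' : ℝ, 0 < η' → ∃ R : ℝ, ∀ z₀ : ℝ × EuclideanSpace ℝ (Fin 3),
      -((2 : ℝ) + 1) < z₀.1 → z₀.1 < 0 → R < ‖z₀.2‖ → cknC 1 z₀ w ≤ ENNReal.ofReal η' := by
    intro η' hη'
    obtain ⟨R, hR⟩ := hfarC η' hη'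
    exact ⟨R, fun z₀ h1 h2 h3 => hR z₀ (by linarith) h2 h3⟩
  obtain ⟨L, R₀, hR₀, hfar⟩ := exists_farField_ae_norm_le_of_cknC_farField_small hw hDK (T := 2) hfarC'
  -- ### Step 8: the Liouville property of the slices, and the endgame
  have hLiou : ∀ᵐ t ∂(volume.restrict (Ioo (-1 : ℝ) 0)),
      ∀ V' : EuclideanSpace ℝ (Fin 3) → EuclideanSpace ℝ (Fin 3),
        InnerProductSpace.HarmonicOnNhd V' (univ : Set (EuclideanSpace ℝ (Fin 3))) → V' =ᵐ[volume] w t → V' = 0 := by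
    refine ae_liouville_of_ae_uloc_of_ae_memHomBesov (s := -1 + 3 / r.toReal) (p := r) (q := q) ?_
    have h := ae_restrict_of_ae_restrict_of_subset (Ioo_subset_Ioo (by norm_num) le_rfl :
      Ioo (-1 : ℝ) (0 : ℝ) ⊆ Ioo (-(5 : ℝ) ^ 2) 0) hslices
    filter_upwards [h] with t ht
    obtain ⟨huloc, W, hW, hWm, -⟩ := ht
    exact ⟨huloc, W, hW, hWm⟩
  have hP : ∀ z₀ : ℝ × EuclideanSpace ℝ (Fin 3), z₀.1 ≤ 0 → ∀ ρ ∈ Ioc (0 : ℝ) 1, cknD ρ z₀ π ≤ K :=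
    fun z₀ hz₀ ρ hρ => hDw z₀ hz₀ ρ hρ.1
  set L' : ℝ := max L 1 with hL'
  have hL'pos : 0 < L' := lt_of_lt_of_le one_pos (le_max_right _ _)
  have hfar' : ∀ᵐ z ∂(volume.restrict (Ioo (-(2 : ℝ)) 0 ×ˢ (closedBall (0 : EuclideanSpace ℝ (Fin 3)) R₀)ᶜ)),
      ‖w z.1 z.2‖ ≤ L' := by
    filter_upwards [hfar] with z hz
    exact hz.trans (le_max_left _ _)
  have hzero := ancient_lintegral_cube_eq_zero_of_farField_le hw hP htop hL'pos hR₀ (T₁ := 2) le_rfl hfar' hLiou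
  -- ### Step 9: contradiction with the non-triviality of the blow-up limit
  set a : ℝ := min 1 L'⁻¹ / 2 with hadef
  have hapos : 0 < a := by rw [hadef]; positivity
  have hη' : ∀ ρ ∈ Ioc (0 : ℝ) (1 / 2), ENNReal.ofReal η ≤ cknC ρ 0 v := by
    intro ρ hρ
    rw [hvdef, cknC_nsZoom hlampos hρ.1 T x₀ 0 u, hst0]
    exact hconcC (lam * ρ) (hrad ρ (hhalf1 ρ hρ))
  have hlow := blowup_lintegral_cube_ge_of hvm hδge hη' hapos (hwm a hapos).aestronglyMeasurable (hconv a hapos)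
  rw [hzero] at hlow
  have h0 : ENNReal.ofReal (a ^ 2 * η) = 0 := le_antisymm hlow bot_le
  rw [ENNReal.ofReal_eq_zero] at h0
  have hpos : 0 < a ^ 2 * η := by positivity
  linarith

end Main



end Literature.Analysis.FluidPDE

end
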